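import Summits.HodgeConjecture.HodgeConjecture.Theorems.Ring2AbelianAllWeilSimilarAnchors
import Literature.AlgebraicGeometry.HodgeTheory.WeilFamilyReach
import Literature.AlgebraicGeometry.HodgeTheory.WeilClassesRationalPlane
import Literature.AlgebraicGeometry.VanGeemen1994.WeilDiscriminantOfHyperbolic
import HarnessLib

/-!
# Venture HSemireg — ONE reach fact instead of two: Deligne's reach BY SIMILITUDE implies the HYPERBOLIC reach
# (`weilFamilyReach_similar → weilFamilyReach_hyperbolic`), by tree theorems only

HONEST FRAMING. A small trust-base leaf of the computation cell `pub-hsemireg` (Sunday typer seat p11 «assembly, g = 2n», third generation).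
Both `HodgeTheory.weilFamilyReach_hyperbolic` and `HodgeTheory.weilFamilyReach_similar` are NAMED FACTS of the tree (Deligne, LNM 900, proof of
Thm. 4.8; REFEREED; neither is proved in the tree — no moduli space of abelian varieties, no universal family, no period map is constructed). The
venture's level-`N` files take one or the other BY NAME: the SPLIT-anchored ladders and § g = 8 ∕ § g = 10 conjunctions of `AmplificationChainAssembly` ∕
`AmplificationChainG2n` ∕ `StructureLadderG2n` and seat p5's `MarkmanClassStatementAssembly` ∕ `…Tower` ∕ the split forms of `…Component` take
`weilFamilyReach_hyperbolic` (43 files of `Summits/Ventures/HSemireg/` mention it on 2026-08-23, 19 the other), the DECIDING-ROW forms of `ComponentCellsRouteC` ∕ `MarkmanClassStatementComponent` ∕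
`AmplificationChainG2n` ∕ `VerdictAssemblyG6` ∕ `ComponentLadderG2n` take `weilFamilyReach_similar`. This file proves that the second implies the
first — so EVERY conclusion of the cell's kernel that is stated over the hyperbolic reach also holds over the by-similitude reach, and the whole
assembly has ONE reach fact in its trust base. Nothing here says HC, HC_CM or HC_AV is proved; no object is certified; neither reach fact is
discharged. 0 `sorry`, 0 `def`, 0 new named fact.

## The proof (Deligne's own remark, on the tree's carriers)

The Literature docstring of `weilFamilyReach_similar` records: «The sibling `weilFamilyReach_hyperbolic` is the special case in which both members
are hyperbolic (two split forms of rank `2n` are isometric, [Deligne1982HodgeCycles, Cor. 4.2])». In the kernel: a hyperbolic anchor `(P, ψ₀, h_K)` and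
a hyperbolic target `(A, φ, h_A)` are of Weil type `(n, d)` (`isWeilType_of_isHyperbolicWeilType`: Deligne's (b) ⟹ (4.4), van Geemen Lemma 5.2 (1));
both `K`-symmetrised classes have the SPLIT discriminant class `[(-1)ⁿ]` (`VanGeemen1994.hasWeilDiscriminantNondeg_neg_one_pow_of_isHyperbolicWeilType`,
Lemma 5.2 (2)–(3) and (5.4.1)); two Weil-type members with Gram witnesses of the SAME class are Weil-similar (ring 2's
`isWeilSimilar_of_hasWeilDiscriminantNondeg` — Landherr's theorem on the carriers, `hermitianMatrices_congruent_iff_invariants`); the anchor's Weil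
class is of type `(n, n)` and the target carries a non-zero `(n, n)` Weil class (`IsWeilType.isOfHodgeType_of_mem_weilClassesOf`,
`exists_isRationalClass_ne_zero_mem_weilClassesOf`); and `weilFamilyReach_similar` then yields exactly the family clause of
`weilFamilyReach_hyperbolic` (`WeilFamilyReaches`, definitionally the same existential).

References: [Deligne1982HodgeCycles] §4, Cor. 4.2, Prop. 4.4, Lemma 4.6, proof of Thm. 4.8 (pp. 47–52); [vanGeemen1994HodgeAV] Lemma 5.2, 5.3–5.5;
[Landherr1936HermitianForms] Satz.
-/

noncomputable section

open CategoryTheory AlgebraicGeometry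
open Literature.AlgebraicGeometry Literature.AlgebraicGeometry.Motives
open Literature.AlgebraicGeometry.HodgeTheory Literature.AlgebraicGeometry.VanGeemen1994
open Literature.AlgebraicTopology.SingularHomology

namespace Summit.Ventures.HSemireg

open Summit.HodgeConjecture.HodgeConjecture.Ring2.Hypotheses
open Summit.HodgeConjecture.HodgeConjecture.Ring2.AbelianAll

/-- **Deligne's reach by similitude implies the hyperbolic reach**: `weilFamilyReach_similar → weilFamilyReach_hyperbolic`. Both are NAMED FACTS
(REFEREED, undischarged); the implication is a tree THEOREM: hyperbolic ⟹ Weil type (Deligne (b) ⟹ (4.4)), hyperbolic ⟹ split discriminant class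
`[(-1)ⁿ]` (van Geemen Lemma 5.2 (2)–(3), (5.4.1)), same class ⟹ Weil-similar (Landherr on the carriers, ring 2), and the Weil planes of Weil-type members
are of type `(n, n)` and non-zero. Consequence for the cell's kernel: every theorem stated BY NAME over `weilFamilyReach_hyperbolic` (the split-anchored
ladders, the § g = 8 ∕ § g = 10 conjunctions, seat p5's Assembly ∕ Tower ∕ Component split forms) holds BY NAME over `weilFamilyReach_similar` alone — apply it to
`weilFamilyReach_hyperbolic_of_similar hF`. [cite: Deligne1982HodgeCycles, §4 Cor. 4.2, Prop. 4.4 and proof of Thm. 4.8 (pp. 47–52)]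
[cite: vanGeemen1994HodgeAV, Lemma 5.2 (1)–(4), 5.3–5.4] [cite: Landherr1936HermitianForms, Satz] -/
theorem weilFamilyReach_hyperbolic_of_similar (hF : weilFamilyReach_similar) : weilFamilyReach_hyperbolic := by
  intro n d hn hd P ψ₀ e a hP hψ ha ha0 hhypP w hwW hw0 A φ eA aA hA hφ haA haA0 hhypA
  have hn' : 0 < n := hn
  have hd' : 0 < d := hd
  -- both members are of Weil type `(n, d)`
  have hWP : IsWeilType P ψ₀ n d := isWeilType_of_isHyperbolicWeilType hn' hd' hP hψ e ha ha0 hhypP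
  have hWA : IsWeilType A φ n d := isWeilType_of_isHyperbolicWeilType hn' hd' hA hφ eA haA haA0 hhypA
  -- the anchor's class is of type `(n, n)`; the target carries a non-zero `(n, n)` Weil class
  have hwH : IsOfHodgeType (2 * n) P.X (2 * n) n n w := hWP.isOfHodgeType_of_mem_weilClassesOf hwW
  obtain ⟨wA, hwAW, hwA0, -⟩ := exists_isRationalClass_ne_zero_mem_weilClassesOf hn' hA hd' hφ
  have hwAH : IsOfHodgeType (2 * n) A.X (2 * n) n n wA := hWA.isOfHodgeType_of_mem_weilClassesOf hwAW
  -- both symmetrised classes have the split discriminant class `[(-1)ⁿ]`, hence the members are Weil-similar (Landherr)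
  have hδP := hasWeilDiscriminantNondeg_neg_one_pow_of_isHyperbolicWeilType hn' hP hd' hψ e ha ha0 hhypP
  have hδA := hasWeilDiscriminantNondeg_neg_one_pow_of_isHyperbolicWeilType hn' hA hd' hφ eA haA haA0 hhypA
  have hsim := isWeilSimilar_of_hasWeilDiscriminantNondeg hWP hWA e ha ha0 eA haA haA0 hδP hδA
  -- Deligne's reach by similitude gives the family clause
  exact hF n d hn hd P ψ₀ e a hP hψ ha ha0 w hwW hw0 hwH A φ eA aA hA hφ haA haA0 ⟨wA, hwAW, hwA0, hwAH⟩ hsim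

/-- **The split anchor reaches every member of the SPLIT component, stated with `WeilFamilyReaches`** (the form the venture's door-agnostic
assembly consumes): BY NAME `weilFamilyReach_similar`; a hyperbolic anchor `(P, ψ₀, h_K)` with a non-zero Weil class `w` and ANY hyperbolic target
`(A, φ, h_A)` of the same `(n, d)` ⟹ `WeilFamilyReaches n d P h_K w A φ`. [cite: Deligne1982HodgeCycles, proof of Thm. 4.8 (pp. 47–52) with Cor. 4.2]
[cite: vanGeemen1994HodgeAV, 5.3–5.4] -/
theorem weilFamilyReaches_of_similar_of_isHyperbolicWeilType (hF : weilFamilyReach_similar) {n d : ℕ} (hn : 0 < n) (hd : 0 < d)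
    {P : AbelianVariety ℂ} {ψ₀ : P ⟶ P} (e : ProjectiveEmbedding P.X) {a : complexBetti (projectiveSpace e.n ℂ) 2}
    (hP : P.dim = 2 * n) (hψ : ψ₀ ≫ ψ₀ = -(d • 𝟙 P)) (ha : IsRationalClass a) (ha0 : a ≠ 0)
    (hhypP : IsHyperbolicWeilType P ψ₀ n
      ((d : ℂ) • complexBetti.map e.ι 2 a + complexBetti.map ψ₀.hom.hom.hom 2 (complexBetti.map e.ι 2 a)))
    {w : complexBetti P.X (2 * n)} (hwW : w ∈ weilClassesOf P ψ₀ n d) (hw0 : w ≠ 0)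
    {A : AbelianVariety ℂ} {φ : A ⟶ A} (eA : ProjectiveEmbedding A.X) {aA : complexBetti (projectiveSpace eA.n ℂ) 2}
    (hA : A.dim = 2 * n) (hφ : φ ≫ φ = -(d • 𝟙 A)) (haA : IsRationalClass aA) (haA0 : aA ≠ 0)
    (hhypA : IsHyperbolicWeilType A φ n
      ((d : ℂ) • complexBetti.map eA.ι 2 aA + complexBetti.map φ.hom.hom.hom 2 (complexBetti.map eA.ι 2 aA))) :
    WeilFamilyReaches n d P
      ((d : ℂ) • complexBetti.map e.ι 2 a + complexBetti.map ψ₀.hom.hom.hom 2 (complexBetti.map e.ι 2 a)) w A φ :=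
  weilFamilyReach_hyperbolic_of_similar hF n d hn hd P ψ₀ e a hP hψ ha ha0 hhypP w hwW hw0 A φ eA aA hA hφ haA haA0 hhypA

end Summit.Ventures.HSemireg

end
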